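import Mathlib
import Summits.Ventures.PercRepro2.Defs
import Summits.Ventures.PercRepro2.Independence
import Summits.Ventures.PercRepro2.Harris
import Summits.Ventures.PercRepro2.Graph
import Summits.Ventures.PercRepro2.Exploration
import Summits.Ventures.PercRepro2.Events
import Summits.Ventures.PercRepro2.FourFunctions
import Summits.Ventures.PercRepro2.Induced
import Summits.Ventures.PercRepro2.Frontier
import Summits.Ventures.PercRepro2.ObsIndependence
import Summits.Ventures.PercRepro2.BHK
import Summits.Ventures.PercRepro2.BHKEvents
import Summits.Ventures.PercRepro2.VdBKahn
import Summits.Ventures.PercRepro2.BHKAvoid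
import Summits.Ventures.PercRepro2.R2PrimeThreeReduction
import Summits.Ventures.PercRepro2.YBridge
import Summits.Ventures.PercRepro2.Yu1Functionals
import Summits.Ventures.PercRepro2.Yu1Events
import Summits.Ventures.PercRepro2.Yu1
import Summits.Ventures.PercRepro2.LBSplit
import Summits.Ventures.PercRepro2.YDelta
import Summits.Ventures.PercRepro2.YDeltaTools
import Summits.Ventures.PercRepro2.SD
import Summits.Ventures.PercRepro2.Lambda
import Summits.Ventures.PercRepro2.LambdaTau
import Summits.Ventures.PercRepro2.LambdaSlack
import Summits.Ventures.PercRepro2.ZDelta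
import Summits.Ventures.PercRepro2.ZLine

import Summits.Ventures.PercRepro2.ZLineBase

/-!
# The line induction: POLAR ∧ SEG-POLAR ∧ (T) ⟹ (ZΔ) (blind cell PercRepro2, typer-1; mine-1
`MINE-1.md` §19.3 LEMMA, lead g9 standing ask 2026-08-23T04:31:19Z `ZDelta_of_polar`)

On `ZLine` / `ZLineBase`:
* **`ZDelta_of_polar`**: on a fixed graph and marking, if POLAR holds on every no-flip line,
  SEG-POLAR on every flip line and (T) at every tie (all for every admissible weight vector), then
  `ZDelta` holds for every admissible labelled weight vector — mine-1's LEMMA 19.3 by strong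
  induction on the number of fractional edges (`fracCount`): no fractional edge is the base case
  `Zq_nonneg_of_det`; otherwise pin a fractional edge `f` to `0` and `1`; on a no-flip line
  `Z_edge_line` + POLAR + the induction hypothesis at both ends; on a flip line the instance lies
  on the labelled sub-segment between the tie point and the labelled end, where `Zq_mix`,
  SEG-POLAR, (T) at the tie point (`labelGap_tiePoint`) and the induction hypothesis at the
  labelled end give `Z ≥ 0`;
* **`ZDelta_all_of_polar`**: the closure form `Polar_all ∧ SegPolar_all ∧ Tie_all → ZDelta_all`.
So the crux of record reduces to the three census-clean Props (0 / 120.9M, 0 / 35.5M lines and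
0 / 17.4M ties at n = 7).
-/

namespace Summit.Ventures.PercRepro2

open UnionCluster

namespace ZLine

open Classical

/-! ## The induction -/

section Induction

variable {V : Type*} {E : Type*} [Fintype E] [DecidableEq E] {R : Type*} [Field R]
  [LinearOrder R] [IsStrictOrderedRing R]

set_option maxHeartbeats 400000 in
/-- **LEMMA 19.3 (mine-1)**: on a fixed graph and marking, POLAR on every no-flip line, SEG-POLAR on
every flip line and (T) at every tie (for every admissible weight vector) give `ZDelta` for every
admissible labelled weight vector — strong induction on the number of fractional edges. -/
theorem ZDelta_of_polar (ends : E → Sym2 V) (o a₁ a₂ a₃ b : V)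
    (hPol : ∀ q : E → R, IsProbVec q → ∀ e, NoFlip q ends a₁ a₂ b e → Polar q ends o a₁ a₂ a₃ b e)
    (hUp : ∀ q : E → R, IsProbVec q → ∀ e, labelGap (Function.update q e 0) ends a₁ a₂ b < 0 →
      0 ≤ labelGap (Function.update q e 1) ends a₁ a₂ b → SegPolarUp q ends o a₁ a₂ a₃ b e)
    (hDown : ∀ q : E → R, IsProbVec q → ∀ e, 0 ≤ labelGap (Function.update q e 0) ends a₁ a₂ b →
      labelGap (Function.update q e 1) ends a₁ a₂ b < 0 → SegPolarDown q ends o a₁ a₂ a₃ b e)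
    (hTie : ∀ q : E → R, IsProbVec q → Tie q ends o a₁ a₂ a₃ b) :
    ∀ p : E → R, IsProbVec p → 0 ≤ labelGap p ends a₁ a₂ b → ZDelta p ends o a₁ a₂ a₃ b := by
  suffices key : ∀ n, ∀ p : E → R, fracCount p = n → IsProbVec p →
      0 ≤ labelGap p ends a₁ a₂ b → 0 ≤ Zq p ends o a₁ a₂ a₃ b by
    intro p hp hlab
    rw [ZDelta_iff_Zq]
    exact key _ p rfl hp hlab
  intro n
  induction n using Nat.strong_induction_on with
  | _ n ih =>
  intro p hn hp hlab
  by_cases hfrac : ∀ e, p e = 0 ∨ p e = 1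
  · exact Zq_nonneg_of_det p hfrac ends o a₁ a₂ a₃ b hlab
  · push Not at hfrac
    obtain ⟨f, hf0, hf1⟩ := hfrac
    have hf : p f ≠ 0 ∧ p f ≠ 1 := ⟨hf0, hf1⟩
    have hp₀v : IsProbVec (Function.update p f 0) := hp.update f le_rfl zero_le_one
    have hp₁v : IsProbVec (Function.update p f 1) := hp.update f zero_le_one le_rfl
    have hc₀ : fracCount (Function.update p f 0) < n := hn ▸ fracCount_update_lt p hf (Or.inl rfl)
    have hc₁ : fracCount (Function.update p f 1) < n := hn ▸ fracCount_update_lt p hf (Or.inr rfl)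
    have hε0 : 0 ≤ p f := hp.nonneg f
    have hε1 : p f ≤ 1 := hp.le_one f
    have hε0' : 0 < p f := lt_of_le_of_ne hε0 (Ne.symm hf0)
    have hε1' : p f < 1 := lt_of_le_of_ne hε1 hf1
    -- the gap of `p` along the line
    have hgap : labelGap p ends a₁ a₂ b =
        p f * labelGap (Function.update p f 1) ends a₁ a₂ b +
          (1 - p f) * labelGap (Function.update p f 0) ends a₁ a₂ b := by
      have := labelGap_at p ends a₁ a₂ b f (p f)
      rwa [Function.update_eq_self] at this
    have hpε : Function.update p f (p f) = p := Function.update_eq_self f p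
    have hZ := Z_edge_line p ends o a₁ a₂ a₃ b f
    by_cases h₀ : 0 ≤ labelGap (Function.update p f 0) ends a₁ a₂ b
    · by_cases h₁ : 0 ≤ labelGap (Function.update p f 1) ends a₁ a₂ b
      · -- no flip
        have hZ₀ := ih _ hc₀ _ rfl hp₀v h₀
        have hZ₁ := ih _ hc₁ _ rfl hp₁v h₁
        have hB := hPol p hp f ⟨h₀, h₁⟩
        unfold Polar at hB
        rw [hZ]
        have h1ε : 0 ≤ 1 - p f := by linarith
        have hm := mul_nonneg (mul_nonneg hε0 h1ε) hB
        have hs₀ := mul_nonneg (pow_two_nonneg (1 - p f)) hZ₀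
        have hs₁ := mul_nonneg (pow_two_nonneg (p f)) hZ₁
        linarith only [hm, hs₀, hs₁]
      · -- flip at the contracted end: `g₀ ≥ 0 > g₁`, the labelled sub-segment is `[v_d, v(ε₀)]`
        push Not at h₁
        have hden : 0 < labelGap (Function.update p f 0) ends a₁ a₂ b -
            labelGap (Function.update p f 1) ends a₁ a₂ b := by linarith
        have hε₀_def : tiePoint p ends a₁ a₂ b f =
            labelGap (Function.update p f 0) ends a₁ a₂ b /
              (labelGap (Function.update p f 0) ends a₁ a₂ b -
                labelGap (Function.update p f 1) ends a₁ a₂ b) := rfl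
        have hε₀0 : 0 ≤ tiePoint p ends a₁ a₂ b f := by
          rw [hε₀_def]
          exact div_nonneg h₀ hden.le
        have hε₀1 : tiePoint p ends a₁ a₂ b f ≤ 1 := by
          rw [hε₀_def, div_le_one hden]
          linarith
        -- the instance lies on the labelled sub-segment: `ε ≤ ε₀`
        have hεε₀ : p f ≤ tiePoint p ends a₁ a₂ b f := by
          rw [hε₀_def, le_div_iff₀ hden]
          nlinarith [hgap, hlab]
        have hε₀pos : 0 < tiePoint p ends a₁ a₂ b f := lt_of_lt_of_le hε0' hεε₀
        -- the pieces
        have hZ₀ := ih _ hc₀ _ rfl hp₀v h₀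
        have hTieε₀ : 0 ≤ Zq (Function.update p f (tiePoint p ends a₁ a₂ b f)) ends o a₁ a₂ a₃ b := by
          rw [← ZDelta_iff_Zq]
          refine hTie _ (hp.update f hε₀0 hε₀1) ?_
          exact labelGap_tiePoint p ends a₁ a₂ b f (by linarith)
        have hB := hDown p hp f h₀ h₁
        unfold SegPolarDown at hB
        -- the segment parameter `t = ε / ε₀`
        have ht0 : 0 ≤ p f / tiePoint p ends a₁ a₂ b f := div_nonneg hε0 hε₀pos.le
        have ht1 : p f / tiePoint p ends a₁ a₂ b f ≤ 1 := by
          rw [div_le_one hε₀pos]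
          exact hεε₀
        have hmix : p f = (1 - p f / tiePoint p ends a₁ a₂ b f) * 0 +
            p f / tiePoint p ends a₁ a₂ b f * tiePoint p ends a₁ a₂ b f := by
          rw [div_mul_cancel₀ _ hε₀pos.ne']
          ring
        have hseg := Zq_mix p ends o a₁ a₂ a₃ b f 0 (tiePoint p ends a₁ a₂ b f)
          (p f / tiePoint p ends a₁ a₂ b f)
        rw [← hmix, hpε] at hseg
        rw [hseg]
        have h1t : 0 ≤ 1 - p f / tiePoint p ends a₁ a₂ b f := by linarith
        have hm := mul_nonneg (mul_nonneg ht0 h1t) hB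
        have hs₀ := mul_nonneg (pow_two_nonneg (1 - p f / tiePoint p ends a₁ a₂ b f)) hZ₀
        have hs₁ := mul_nonneg (pow_two_nonneg (p f / tiePoint p ends a₁ a₂ b f)) hTieε₀
        linarith only [hm, hs₀, hs₁]
    · push Not at h₀
      by_cases h₁ : 0 ≤ labelGap (Function.update p f 1) ends a₁ a₂ b
      · -- flip at the deleted end: `g₀ < 0 ≤ g₁`, the labelled sub-segment is `[v(ε₀), v_c]`
        have hden : labelGap (Function.update p f 0) ends a₁ a₂ b -
            labelGap (Function.update p f 1) ends a₁ a₂ b < 0 := by linarith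
        have hε₀_def : tiePoint p ends a₁ a₂ b f =
            labelGap (Function.update p f 0) ends a₁ a₂ b /
              (labelGap (Function.update p f 0) ends a₁ a₂ b -
                labelGap (Function.update p f 1) ends a₁ a₂ b) := rfl
        have hε₀0 : 0 ≤ tiePoint p ends a₁ a₂ b f := by
          rw [hε₀_def]
          exact div_nonneg_of_nonpos h₀.le hden.le
        have hε₀1 : tiePoint p ends a₁ a₂ b f ≤ 1 := by
          rw [hε₀_def, div_le_iff_of_neg hden]
          linarith
        -- the instance lies on the labelled sub-segment: `ε₀ ≤ ε`
        have hε₀ε : tiePoint p ends a₁ a₂ b f ≤ p f := by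
          rw [hε₀_def, div_le_iff_of_neg hden]
          nlinarith [hgap, hlab]
        have hε₀lt : tiePoint p ends a₁ a₂ b f < 1 := lt_of_le_of_lt hε₀ε hε1'
        -- the pieces
        have hZ₁ := ih _ hc₁ _ rfl hp₁v h₁
        have hTieε₀ : 0 ≤ Zq (Function.update p f (tiePoint p ends a₁ a₂ b f)) ends o a₁ a₂ a₃ b := by
          rw [← ZDelta_iff_Zq]
          refine hTie _ (hp.update f hε₀0 hε₀1) ?_
          exact labelGap_tiePoint p ends a₁ a₂ b f (by linarith)
        have hB := hUp p hp f h₀ h₁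
        unfold SegPolarUp at hB
        -- the segment parameter `t = (ε − ε₀) / (1 − ε₀)`
        have hden' : 0 < 1 - tiePoint p ends a₁ a₂ b f := by linarith
        have ht0 : 0 ≤ (p f - tiePoint p ends a₁ a₂ b f) / (1 - tiePoint p ends a₁ a₂ b f) :=
          div_nonneg (by linarith) hden'.le
        have ht1 : (p f - tiePoint p ends a₁ a₂ b f) / (1 - tiePoint p ends a₁ a₂ b f) ≤ 1 := by
          rw [div_le_one hden']
          linarith
        have hmul : (p f - tiePoint p ends a₁ a₂ b f) / (1 - tiePoint p ends a₁ a₂ b f) *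
            (1 - tiePoint p ends a₁ a₂ b f) = p f - tiePoint p ends a₁ a₂ b f :=
          div_mul_cancel₀ _ hden'.ne'
        have hmix : p f =
            (1 - (p f - tiePoint p ends a₁ a₂ b f) / (1 - tiePoint p ends a₁ a₂ b f)) *
                tiePoint p ends a₁ a₂ b f +
              (p f - tiePoint p ends a₁ a₂ b f) / (1 - tiePoint p ends a₁ a₂ b f) * 1 := by
          linear_combination -hmul
        have hseg := Zq_mix p ends o a₁ a₂ a₃ b f (tiePoint p ends a₁ a₂ b f) 1
          ((p f - tiePoint p ends a₁ a₂ b f) / (1 - tiePoint p ends a₁ a₂ b f))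
        rw [← hmix, hpε] at hseg
        rw [hseg]
        have h1t : 0 ≤ 1 - (p f - tiePoint p ends a₁ a₂ b f) / (1 - tiePoint p ends a₁ a₂ b f) := by
          linarith
        have hm := mul_nonneg (mul_nonneg ht0 h1t) hB
        have hs₀ := mul_nonneg
          (pow_two_nonneg (1 - (p f - tiePoint p ends a₁ a₂ b f) / (1 - tiePoint p ends a₁ a₂ b f)))
          hTieε₀
        have hs₁ := mul_nonneg
          (pow_two_nonneg ((p f - tiePoint p ends a₁ a₂ b f) / (1 - tiePoint p ends a₁ a₂ b f))) hZ₁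
        linarith only [hm, hs₀, hs₁]
      · -- both ends flipped: impossible under the labelling of `p`
        push Not at h₁
        exfalso
        have : labelGap p ends a₁ a₂ b < 0 := by
          rw [hgap]
          nlinarith only [mul_pos hε0' (neg_pos.2 h₁), mul_nonneg (sub_nonneg.2 hε1) (neg_nonneg.2 h₀.le)]
        linarith

end Induction

section Closure

variable (R : Type*) [Field R] [LinearOrder R] [IsStrictOrderedRing R]

/-- **The crux from the three line Props**: `Polar_all ∧ SegPolar_all ∧ Tie_all → ZDelta_all`. -/
theorem ZDelta_all_of_polar (hPol : Polar_all R) (hSeg : SegPolar_all R) (hTie : Tie_all R) :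
    ZDelta_all R := by
  intro V E _ _ _ _ ends p hp o a₁ a₂ a₃ b h12 h13 h23 ho1 ho2 ho3 hob hb1 hb2 hb3 hord
  have hlab : 0 ≤ labelGap p ends a₁ a₂ b := by
    unfold labelGap
    linarith
  refine ZDelta_of_polar ends o a₁ a₂ a₃ b ?_ ?_ ?_ ?_ p hp hlab
  · intro q hq e hnf
    exact hPol V E ends q hq o a₁ a₂ a₃ b h12 h13 h23 ho1 ho2 ho3 hob hb1 hb2 hb3 e hnf
  · intro q hq e h0 h1
    exact (hSeg V E ends q hq o a₁ a₂ a₃ b h12 h13 h23 ho1 ho2 ho3 hob hb1 hb2 hb3 e).1 h0 h1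
  · intro q hq e h0 h1
    exact (hSeg V E ends q hq o a₁ a₂ a₃ b h12 h13 h23 ho1 ho2 ho3 hob hb1 hb2 hb3 e).2 h0 h1
  · intro q hq
    exact hTie V E ends q hq o a₁ a₂ a₃ b h12 h13 h23 ho1 ho2 ho3 hob hb1 hb2 hb3

end Closure

end ZLine

end Summit.Ventures.PercRepro2
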